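import Literature.NumberTheory.GaloisRepresentations.GaloisCohomologyLayerInflationTransitive
import Literature.NumberTheory.GaloisRepresentations.GaloisCohomologyUnitsLayerInflation
import Literature.NumberTheory.GaloisRepresentations.ProfiniteIntersectionCocycleExtension
import HarnessLib

/-!
# `H²(K, M) = lim→_E H²(Gal(E/K), M^{Γ_E})` for a discrete `Γ_K`-module `M`: a layer class dies in
# `H²(K, M)` iff it dies in a bigger finite layer; every class comes from a finite layer
# (Serre, *Galois Cohomology* I §2.2 Prop. 8, degree `2`)

Topic `NumberTheory/GaloisRepresentations`; namespace `Literature.NumberTheory.GaloisRepresentations`.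
Proof file: theorems only (no definition, no named fact, no instance, no notation; D-0026).  Sequel to
`GaloisCohomologyLayerInflationTransitive` (door-c6 g10: the transition maps `layerInf E E' h n` of the
directed system of finite Galois layers, `infTwo ρ E' ∘ layerInf = infTwo ρ E`) and companion of
`GaloisCohomologyLayerInflationUnion` (`exists_infTwo_eq`: every class of `H²(K, M)` comes from a finite layer).

* **`exists_layerInf_two_eq_zero_of_infTwo_eq_zero`** — for a field `K : Type`, ANY discrete
  `Γ_K`-module `M`, a finite normal layer `E ⊆ K̄` and `y ∈ H²(Γ_K ⧸ Γ_E, M^{Γ_E})` (Mathlib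
  `groupCohomology`): if `infTwo ρ E y = 0` in `H²(K, M)` then `layerInf E E' h 2 y = 0` for some finite normal
  `E' ⊇ E`.  Proof (Serre's): `inf f = ∂b` for a continuous 1-cochain `b : Γ_K → M`
  (`twoCocycleClass_eq_zero_iff`); `b` is uniformly locally constant with finitely many values, whose
  common stabiliser is open, so for a
  finite Galois `E₀` with `Γ_{E₀}` small (`exists_finiteDimensional_isGalois_of_mem_nhds_one`) and
  `E' = E ⊔ E₀`, `b` descends to `b' : Γ_K ⧸ Γ_{E'} → M^{Γ_{E'}}` with `Inf_{E→E'} f = ∂b'` on the nose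
  (Mathlib `H2π_eq_zero_iff`, `d₁₂`).
* `infTwo_eq_zero_iff_exists_layerInf_eq_zero` — the iff form (with `infTwo_layerInf`).

* **`exists_infTwo_eq_of_discrete`** — the surjectivity side for ANY discrete `M` (the finitely many values of
  a continuous 2-cocycle on the compact `Γ_K × Γ_K` have an open common stabiliser), generalising
  `exists_infTwo_eq` of `GaloisCohomologyLayerInflationUnion` (finite `M`).
* `infTwo_eq_infTwo_iff_exists_layerInf_eq` — two layer classes have the same image in `H²(K, M)` iff they
  agree in a common bigger layer (`layerInf_layerInf_two`: the transitions compose).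

So Serre I §2.2 Prop. 8 holds in degree `2` for every discrete module: `H²(K, M)` IS the direct limit of
Mathlib's `H²(Gal(E/K), M^{Γ_E})` along the `layerInf` — in particular for `M = K̄ˣ` (`Br(K) = ⋃ Br(E/K)`)
and for the idèle class module `C̄` of a number field (`H²(K, C̄) = ⋃ inf H²(Gal(E/K), C_E)`, the group on
which the global invariant of Route A lives); the shape in which the class-module engine's finite-layer
results are assembled (Milne I Lemma 1.9: classes killed IN THE LIMIT).
* `infOneLayer_eq_infOneLayer_iff_layerInf_eq` (degree one needs no further layer: `infOneLayer` is
  injective) and, for `M = K̄ˣ` over a field of characteristic `0`: **`exists_unitsInfTwo_eq` —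
  `Br(K) = ⋃_E unitsInfTwo H²(Gal(E/K), Eˣ)`** (Serre X §4 Cor. to Prop. 6): the engine's units layers
  exhaust the Brauer group.

HONEST FRAMING: homological algebra only.

## References
* J.-P. Serre, *Local Fields*, GTM 67 (1979), Ch. X §4 Prop. 6 and Cor. [SerreLocalFields1979]
* J.-P. Serre, *Galois Cohomology* (1997), Ch. I §2.2 Prop. 8 and Cor. 1. [SerreGaloisCohomology1997]
* J. Neukirch, A. Schmidt, K. Wingberg, *Cohomology of Number Fields* (2008), (1.2.5), (1.5.1).
  [NeukirchSchmidtWingberg2008]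
-/

noncomputable section

open CategoryTheory groupCohomology Field Function
open scoped Topology

namespace Literature.NumberTheory.GaloisRepresentations

open LocalWeilDatum

variable (K : Type) [Field K]
variable (E : IntermediateField K (AlgebraicClosure K)) [FiniteDimensional K E] [Normal K E]
variable {M : Type} [AddCommGroup M] [TopologicalSpace M] [DiscreteTopology M] (ρ : DiscreteGaloisModule K M)

omit [FiniteDimensional K E] in
/-- **The transition maps compose (degree two, on classes)**: `Inf_{F→E'} (Inf_{E→F} y) = Inf_{E→E'} y`
for `E ≤ F ≤ E'` — both sides are the class of the cocycle `(q₁, q₂) ↦ f(q̄₁, q̄₂)`.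
[cite: SerreGaloisCohomology1997, I §2.2 Prop. 8][cite: NeukirchSchmidtWingberg2008, (1.5.2)] -/
theorem layerInf_layerInf_two (F E' : IntermediateField K (AlgebraicClosure K)) [Normal K F] [Normal K E']
    (h₁ : E ≤ F) (h₂ : F ≤ E') (y : groupCohomology (absGaloisLayerRep K E ρ) 2) :
    layerInf K F E' ρ h₂ 2 (layerInf K E F ρ h₁ 2 y) = layerInf K E E' ρ (h₁.trans h₂) 2 y := by
  induction y using H2_induction_on with
  | h f =>
  have e1 : layerInf K E F ρ h₁ 2 (H2π (absGaloisLayerRep K E ρ) f) =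
      H2π (absGaloisLayerRep K F ρ) (mapCocycles₂ (layerQuotientMap K E F h₁) (layerInclHom K E F ρ h₁) f) :=
    H2π_comp_map_apply (layerQuotientMap K E F h₁) (layerInclHom K E F ρ h₁) f
  have e2 : layerInf K F E' ρ h₂ 2 (H2π (absGaloisLayerRep K F ρ)
        (mapCocycles₂ (layerQuotientMap K E F h₁) (layerInclHom K E F ρ h₁) f)) =
      H2π (absGaloisLayerRep K E' ρ) (mapCocycles₂ (layerQuotientMap K F E' h₂) (layerInclHom K F E' ρ h₂)
        (mapCocycles₂ (layerQuotientMap K E F h₁) (layerInclHom K E F ρ h₁) f)) :=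
    H2π_comp_map_apply (layerQuotientMap K F E' h₂) (layerInclHom K F E' ρ h₂) _
  have e3 : layerInf K E E' ρ (h₁.trans h₂) 2 (H2π (absGaloisLayerRep K E ρ) f) =
      H2π (absGaloisLayerRep K E' ρ)
        (mapCocycles₂ (layerQuotientMap K E E' (h₁.trans h₂)) (layerInclHom K E E' ρ (h₁.trans h₂)) f) :=
    H2π_comp_map_apply (layerQuotientMap K E E' (h₁.trans h₂)) (layerInclHom K E E' ρ (h₁.trans h₂)) f
  have hc : mapCocycles₂ (layerQuotientMap K F E' h₂) (layerInclHom K F E' ρ h₂)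
        (mapCocycles₂ (layerQuotientMap K E F h₁) (layerInclHom K E F ρ h₁) f) =
      mapCocycles₂ (layerQuotientMap K E E' (h₁.trans h₂)) (layerInclHom K E E' ρ (h₁.trans h₂)) f := by
    refine Subtype.ext (funext fun p => ?_)
    obtain ⟨q₁, q₂⟩ := p
    induction q₁ using QuotientGroup.induction_on with
    | H σ =>
    induction q₂ using QuotientGroup.induction_on with
    | H τ =>
    rfl
  rw [e1, e2, hc, e3]

/-- **A layer class that dies in `H²(K, M)` dies in a bigger finite layer** (finite `M`): if
`infTwo ρ E y = 0` then `layerInf E E' h 2 y = 0` for some finite normal `E' = E ⊔ E₀ ⊇ E`.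
[cite: SerreGaloisCohomology1997, I §2.2 Prop. 8][cite: NeukirchSchmidtWingberg2008, (1.2.5)] -/
theorem exists_layerInf_two_eq_zero_of_infTwo_eq_zero
    (y : groupCohomology (absGaloisLayerRep K E ρ) 2) (hy : infTwo K E ρ y = 0) :
    ∃ (E' : IntermediateField K (AlgebraicClosure K)) (_ : FiniteDimensional K E') (_ : Normal K E')
      (h : E ≤ E'), layerInf K E E' ρ h 2 y = 0 := by
  classical
  haveI : CompactSpace (absoluteGaloisGroup K) := absoluteGaloisGroup_compactSpace K
  induction y using H2_induction_on with
  | h f =>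
  -- `inf f = ∂b` for a continuous 1-cochain `b`
  rw [infTwo_H2π] at hy
  obtain ⟨b, hb⟩ := (twoCocycleClass_eq_zero_iff _ (inflateTwoCocycle K E ρ f)).1 hy
  -- `b` takes finitely many values (compact source, discrete target); their common stabiliser is open
  have hfin : (Set.range b).Finite := (isCompact_range b.continuous).finite_of_discrete
  have hU₀ : (⋂ a ∈ Set.range b, {g : absoluteGaloisGroup K | ρ g a = a}) ∈ 𝓝 (1 : absoluteGaloisGroup K) :=
    (Filter.biInter_mem hfin).2 fun a _ => ρ.setOf_apply_eq_mem_nhds_one a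
  -- uniform local constancy of `b`
  obtain ⟨V, hV, hVb⟩ := exists_nhds_one_forall_eq' (X := absoluteGaloisGroup K) (P := absoluteGaloisGroup K)
    (fun z v => b (z * v)) (b.continuous.comp continuous_mul)
  -- a finite Galois `E₀` with `Γ_{E₀}` inside both, and `E' = E ⊔ E₀`
  obtain ⟨E₀, hE₀fd, hE₀gal, hE₀U⟩ := exists_finiteDimensional_isGalois_of_mem_nhds_one K
    (Filter.inter_mem hU₀ hV)
  haveI := hE₀fd
  haveI := hE₀gal
  let E' : IntermediateField K (AlgebraicClosure K) := E ⊔ E₀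
  have hEE' : E ≤ E' := le_sup_left
  have hΓ : ∀ u ∈ absGaloisFixingSubgroup E',
      u ∈ (⋂ a ∈ Set.range b, {g : absoluteGaloisGroup K | ρ g a = a}) ∩ V := fun u hu =>
    hE₀U u ((mem_absGaloisFixingSubgroup_iff E₀ u).1
      (absGaloisFixingSubgroup_antitone K E₀ E' le_sup_right hu))
  have htriv : ∀ u ∈ absGaloisFixingSubgroup E', ∀ x : absoluteGaloisGroup K, ρ u (b x) = b x :=
    fun u hu x => (Set.mem_iInter₂.1 (hΓ u hu).1) (b x) ⟨x, rfl⟩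
  have hconst : ∀ σ u : absoluteGaloisGroup K, u ∈ absGaloisFixingSubgroup E' → b (σ * u) = b σ :=
    fun σ u hu => by
      have h := hVb σ u (hΓ u hu).2
      rwa [mul_one] at h
  -- the descended 1-cochain of the quotient `Γ_K ⧸ Γ_{E'}`, through `Quotient.out` representatives
  set Q' := absoluteGaloisGroup K ⧸ absGaloisFixingSubgroup E' with hQ'
  have hout : ∀ σ : absoluteGaloisGroup K, ∃ u ∈ absGaloisFixingSubgroup E', ((σ : Q')).out = σ * u :=
    fun σ => by
      obtain ⟨u, hu⟩ := QuotientGroup.mk_out_eq_mul (absGaloisFixingSubgroup E') σ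
      exact ⟨u, u.2, hu⟩
  let b' : Q' → Representation.invariants (ρ.toRepresentation.comp (absGaloisFixingSubgroup E').subtype) :=
    fun q => ⟨b q.out, fun s => htriv s s.2 q.out⟩
  have hb'_mk : ∀ σ : absoluteGaloisGroup K, (b' (σ : Q') : M) = b σ := fun σ => by
    obtain ⟨u, hu, hσ⟩ := hout σ
    change b ((σ : Q')).out = _
    rw [hσ, hconst σ u hu]
  -- `Inf_{E → E'} f = ∂ b'` on the nose
  have hd : (d₁₂ (absGaloisLayerRep K E' ρ)).hom b' =
      ⇑(mapCocycles₂ (layerQuotientMap K E E' hEE') (layerInclHom K E E' ρ hEE') f) := by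
    funext p
    obtain ⟨q₁, q₂⟩ := p
    induction q₁ using QuotientGroup.induction_on with
    | H σ =>
    induction q₂ using QuotientGroup.induction_on with
    | H τ =>
    rw [d₁₂_hom_apply, coe_mapCocycles₂]
    refine Subtype.ext ?_
    -- both sides equal `σ b(τ) - b(στ) + b(σ)` in `M`
    have hL : (((absGaloisLayerRep K E' ρ).ρ (σ : Q') (b' (τ : Q')) - b' ((σ : Q') * (τ : Q')) +
        b' (σ : Q') : Representation.invariants
          (ρ.toRepresentation.comp (absGaloisFixingSubgroup E').subtype)) : M) =
        ρ σ (b τ) - b (σ * τ) + b σ := by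
      rw [← QuotientGroup.mk_mul, Submodule.coe_add, Submodule.coe_sub, hb'_mk, hb'_mk,
        layerRep_ρ_mk_apply_coe, hb'_mk]
    have hR : ((cochainsMap₂ (layerQuotientMap K E E' hEE') (layerInclHom K E E' ρ hEE') f
        ((σ : Q'), (τ : Q')) : Representation.invariants
          (ρ.toRepresentation.comp (absGaloisFixingSubgroup E').subtype)) : M) =
        (inflateTwoCocycle K E ρ f).1 (σ, τ) := rfl
    exact hL.trans ((hb σ τ).symm.trans hR.symm)
  refine ⟨E', inferInstance, inferInstance, hEE', ?_⟩
  have e1 : layerInf K E E' ρ hEE' 2 (H2π (absGaloisLayerRep K E ρ) f) =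
      H2π (absGaloisLayerRep K E' ρ)
        (mapCocycles₂ (layerQuotientMap K E E' hEE') (layerInclHom K E E' ρ hEE') f) :=
    H2π_comp_map_apply (layerQuotientMap K E E' hEE') (layerInclHom K E E' ρ hEE') f
  rw [e1, H2π_eq_zero_iff]
  exact ⟨b', hd⟩

/-- **`H²(K, M) = lim→ H²(Gal(E/K), M^{Γ_E})` (finite `M`), injectivity clause as an iff**: a layer class
maps to `0` in `H²(K, M)` iff it maps to `0` in some bigger finite layer.
[cite: SerreGaloisCohomology1997, I §2.2 Prop. 8][cite: NeukirchSchmidtWingberg2008, (1.2.5)] -/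
theorem infTwo_eq_zero_iff_exists_layerInf_eq_zero (y : groupCohomology (absGaloisLayerRep K E ρ) 2) :
    infTwo K E ρ y = 0 ↔ ∃ (E' : IntermediateField K (AlgebraicClosure K)) (_ : FiniteDimensional K E')
      (_ : Normal K E') (h : E ≤ E'), layerInf K E E' ρ h 2 y = 0 := by
  refine ⟨exists_layerInf_two_eq_zero_of_infTwo_eq_zero K E ρ y, ?_⟩
  rintro ⟨E', hfd, hn, h, h0⟩
  haveI := hfd
  haveI := hn
  rw [← infTwo_layerInf K E E' ρ h y, h0, map_zero]

/-- **Two layer classes have the same image in `H²(K, M)` iff they agree in a common bigger finite layer**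
(finite `M`; layers `E₁`, `E₂`, compared in some `E' ⊇ E₁ ⊔ E₂`).
[cite: SerreGaloisCohomology1997, I §2.2 Prop. 8] -/
theorem infTwo_eq_infTwo_iff_exists_layerInf_eq
    (E₂ : IntermediateField K (AlgebraicClosure K)) [FiniteDimensional K E₂] [Normal K E₂]
    (y₁ : groupCohomology (absGaloisLayerRep K E ρ) 2) (y₂ : groupCohomology (absGaloisLayerRep K E₂ ρ) 2) :
    infTwo K E ρ y₁ = infTwo K E₂ ρ y₂ ↔
      ∃ (E' : IntermediateField K (AlgebraicClosure K)) (_ : FiniteDimensional K E') (_ : Normal K E')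
        (h₁ : E ≤ E') (h₂ : E₂ ≤ E'), layerInf K E E' ρ h₁ 2 y₁ = layerInf K E₂ E' ρ h₂ 2 y₂ := by
  constructor
  · intro heq
    -- move both to `E ⊔ E₂`, then kill the difference in a bigger layer
    let F : IntermediateField K (AlgebraicClosure K) := E ⊔ E₂
    have h₁ : E ≤ F := le_sup_left
    have h₂ : E₂ ≤ F := le_sup_right
    have hdiff : infTwo K F ρ (layerInf K E F ρ h₁ 2 y₁ - layerInf K E₂ F ρ h₂ 2 y₂) = 0 := by
      rw [map_sub, infTwo_layerInf, infTwo_layerInf, heq, sub_self]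
    obtain ⟨E', hfd, hn, hF, h0⟩ :=
      exists_layerInf_two_eq_zero_of_infTwo_eq_zero K F ρ _ hdiff
    haveI := hfd
    haveI := hn
    refine ⟨E', hfd, hn, h₁.trans hF, h₂.trans hF, ?_⟩
    rw [map_sub, sub_eq_zero] at h0
    -- transitivity of the transition maps: `Inf_{F→E'} ∘ Inf_{E→F} = Inf_{E→E'}`
    have t₁ := layerInf_layerInf_two K E ρ F E' h₁ hF y₁
    have t₂ := layerInf_layerInf_two K E₂ ρ F E' h₂ hF y₂
    rw [t₁, t₂] at h0
    exact h0
  · rintro ⟨E', hfd, hn, h₁, h₂, h12⟩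
    haveI := hfd
    haveI := hn
    rw [← infTwo_layerInf K E E' ρ h₁ y₁, h12, infTwo_layerInf K E₂ E' ρ h₂ y₂]

/-- **`H²(K, M)` is the union of the inflations from its finite Galois layers, for ANY discrete `M`**
(Serre I §2.2 Cor. 1 to Prop. 8 in degree `2`): every `x ∈ H²(K, M)` is `infTwo ρ E y` for a finite Galois
`E ⊆ K̄` and a class `y` of Mathlib's `H²(Γ_K ⧸ Γ_E, M^{Γ_E})`.  (The finite-`M` case is
`exists_infTwo_eq`; here the open kernel of the action is replaced by the common stabiliser of the finitely
many values of a representing continuous 2-cocycle.)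
[cite: SerreGaloisCohomology1997, I §2.2 Prop. 8 and Cor. 1][cite: NeukirchSchmidtWingberg2008, (1.2.5)] -/
theorem exists_infTwo_eq_of_discrete (x : galoisCohomology ρ 2) :
    ∃ (E : IntermediateField K (AlgebraicClosure K)) (_ : FiniteDimensional K E) (_ : IsGalois K E)
      (y : groupCohomology (absGaloisLayerRep K E ρ) 2), infTwo K E ρ y = x := by
  classical
  haveI : CompactSpace (absoluteGaloisGroup K) := absoluteGaloisGroup_compactSpace K
  obtain ⟨c, rfl⟩ := twoCocycleClass_surjective ρ.toTopRep x
  -- the finitely many values of `c` have an open common stabiliser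
  have hfin : (Set.range c.1).Finite := (isCompact_range c.1.continuous).finite_of_discrete
  have hU₀ : (⋂ a ∈ Set.range c.1, {g : absoluteGaloisGroup K | ρ g a = a}) ∈ 𝓝 (1 : absoluteGaloisGroup K) :=
    (Filter.biInter_mem hfin).2 fun a _ => ρ.setOf_apply_eq_mem_nhds_one a
  -- uniform local constancy of `c`
  obtain ⟨V, hV, hVc⟩ := exists_nhds_one_forall_eq'
    (X := absoluteGaloisGroup K × absoluteGaloisGroup K) (P := absoluteGaloisGroup K × absoluteGaloisGroup K)
    (fun z v => c.1 (z * v)) (c.1.continuous.comp continuous_mul)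
  obtain ⟨V₁, hV₁, V₂, hV₂, hV₁₂⟩ := mem_nhds_prod_iff.1 hV
  obtain ⟨E, hEfd, hEgal, hEU⟩ := exists_finiteDimensional_isGalois_of_mem_nhds_one K
    (Filter.inter_mem hU₀ (Filter.inter_mem hV₁ hV₂))
  haveI := hEfd
  haveI := hEgal
  have hmemU : ∀ u ∈ absGaloisFixingSubgroup E,
      u ∈ (⋂ a ∈ Set.range c.1, {g : absoluteGaloisGroup K | ρ g a = a}) ∩ (V₁ ∩ V₂) := fun u hu =>
    hEU u ((mem_absGaloisFixingSubgroup_iff E u).1 hu)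
  have htriv : ∀ u ∈ absGaloisFixingSubgroup E, ∀ p : absoluteGaloisGroup K × absoluteGaloisGroup K,
      ρ u (c.1 p) = c.1 p := fun u hu p => (Set.mem_iInter₂.1 (hmemU u hu).1) (c.1 p) ⟨p, rfl⟩
  have hconst : ∀ σ τ u u' : absoluteGaloisGroup K, u ∈ absGaloisFixingSubgroup E →
      u' ∈ absGaloisFixingSubgroup E → c.1 (σ * u, τ * u') = c.1 (σ, τ) := fun σ τ u u' hu hu' => by
    have h := hVc (σ, τ) (u, u') (hV₁₂ (Set.mk_mem_prod (hmemU u hu).2.1 (hmemU u' hu').2.2))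
    rwa [mul_one, Prod.mk_mul_mk] at h
  set Q := absoluteGaloisGroup K ⧸ absGaloisFixingSubgroup E with hQ
  have hout : ∀ σ : absoluteGaloisGroup K, ∃ u ∈ absGaloisFixingSubgroup E, ((σ : Q)).out = σ * u :=
    fun σ => by
      obtain ⟨u, hu⟩ := QuotientGroup.mk_out_eq_mul (absGaloisFixingSubgroup E) σ
      exact ⟨u, u.2, hu⟩
  let f : Q × Q → Representation.invariants (ρ.toRepresentation.comp (absGaloisFixingSubgroup E).subtype) :=
    fun q => ⟨c.1 (q.1.out, q.2.out), fun s => htriv s s.2 _⟩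
  have hf_mk : ∀ σ τ : absoluteGaloisGroup K, (f ((σ : Q), (τ : Q)) : M) = c.1 (σ, τ) := fun σ τ => by
    obtain ⟨u, hu, hσ⟩ := hout σ
    obtain ⟨u', hu', hτ⟩ := hout τ
    change c.1 (((σ : Q)).out, ((τ : Q)).out) = _
    rw [hσ, hτ, hconst σ τ u u' hu hu']
  have hf : f ∈ cocycles₂ (absGaloisLayerRep K E ρ) := by
    rw [mem_cocycles₂_iff]
    intro g h j
    induction g using QuotientGroup.induction_on with
    | H σ =>
    induction h using QuotientGroup.induction_on with
    | H τ =>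
    induction j using QuotientGroup.induction_on with
    | H υ =>
    refine Subtype.ext ?_
    change (f (((σ : Q) * (τ : Q)), (υ : Q)) : M) + (f ((σ : Q), (τ : Q)) : M) =
      ρ σ (f ((τ : Q), (υ : Q)) : M) + (f ((σ : Q), ((τ : Q) * (υ : Q))) : M)
    rw [← QuotientGroup.mk_mul, ← QuotientGroup.mk_mul, hf_mk, hf_mk, hf_mk, hf_mk]
    exact (c.2 σ τ υ).symm
  refine ⟨E, hEfd, hEgal, H2π (absGaloisLayerRep K E ρ) ⟨f, hf⟩, ?_⟩
  rw [infTwo_H2π]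
  congr 1
  refine Subtype.ext (ContinuousMap.ext fun p => ?_)
  obtain ⟨σ, τ⟩ := p
  rw [inflateTwoCocycle_apply]
  exact hf_mk σ τ

/-- **Degree one**: two layer classes have the same image in `H¹(K, M)` iff they agree in `E ⊔ E₂`
(inflation in degree one is injective, so no further layer is needed).
[cite: SerreGaloisCohomology1997, I §2.2 Prop. 8, §2.6 (b)] -/
theorem infOneLayer_eq_infOneLayer_iff_layerInf_eq
    (E₂ : IntermediateField K (AlgebraicClosure K)) [FiniteDimensional K E₂] [Normal K E₂]
    (y₁ : groupCohomology (absGaloisLayerRep K E ρ) 1) (y₂ : groupCohomology (absGaloisLayerRep K E₂ ρ) 1) :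
    infOneLayer K E ρ y₁ = infOneLayer K E₂ ρ y₂ ↔
      layerInf K E (E ⊔ E₂) ρ le_sup_left 1 y₁ = layerInf K E₂ (E ⊔ E₂) ρ le_sup_right 1 y₂ := by
  constructor
  · intro heq
    apply infOneLayer_injective K (E ⊔ E₂) ρ
    rw [infOneLayer_layerInf, infOneLayer_layerInf, heq]
  · intro h
    rw [← infOneLayer_layerInf K E (E ⊔ E₂) ρ le_sup_left y₁, h, infOneLayer_layerInf]

/-! ### The Brauer group is the union of the relative Brauer groups of the finite Galois layers -/

section Brauer

variable (K₀ : Type) [Field K₀] [CharZero K₀]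

/-- **`Br(K) = ⋃_E H²(Gal(E/K), Eˣ)`** (Serre, *Local Fields* X §4, Cor. to Prop. 6: "the Brauer group is
the union of the `H²(E/K)`"): every class of `H²(K, K̄ˣ)` is `unitsInfTwo` of a class of the engine's
units layer `H²(Gal(E/K), Eˣ)` (`Rep.ofAlgebraAutOnUnits`) for some finite Galois `E ⊆ K̄` — for every
field `K` of characteristic `0` (`exists_infTwo_eq_of_discrete` for the discrete module `K̄ˣ` + door-c6 g9's
`unitsLayerH2Iso`). [cite: SerreLocalFields1979, Ch. X §4 Prop. 6 and Cor.][cite: SerreGaloisCohomology1997, I §2.2 Cor. 1 to Prop. 8] -/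
theorem exists_unitsInfTwo_eq (c : galoisCohomology (DiscreteGaloisModule.units K₀) 2) :
    ∃ (E : IntermediateField K₀ (AlgebraicClosure K₀)) (_ : FiniteDimensional K₀ E) (_ : IsGalois K₀ E)
      (x : groupCohomology (Rep.ofAlgebraAutOnUnits K₀ E) 2), unitsInfTwo K₀ E x = c := by
  obtain ⟨E, hfd, hgal, y, hy⟩ := exists_infTwo_eq_of_discrete K₀ (DiscreteGaloisModule.units K₀) c
  haveI := hfd
  haveI := hgal
  exact ⟨E, hfd, hgal, (unitsLayerH2Iso K₀ E).hom y, (unitsInfTwo_apply_hom K₀ E y).trans hy⟩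

end Brauer

end Literature.NumberTheory.GaloisRepresentations

end
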